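import Literature.NumberTheory.Sieve.FriedlanderIwaniecPrimesPoisson
import Literature.NumberTheory.Sieve.FriedlanderIwaniecPrimesGcdSums
import Literature.NumberTheory.LFunctions.ZeroDensityInghamTools
import HarnessLib

/-!
# Fourier-coefficient sums with gcd weights for the dispersion method

Topic `NumberTheory/LFunctions` (harmonic analysis for exponential-sum estimates).  Tools for the
`h`-sum of a Linnik–type dispersion after Poisson summation in the long variable (E. Bombieri,
J. B. Friedlander, H. Iwaniec, *Primes in arithmetic progressions to large moduli*, Acta Math. 156
(1986), §6 (6.9)–(6.12) and §9; H. Iwaniec, E. Kowalski, *Analytic Number Theory*, §4.3): for a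
smooth weight `F` supported in `[R/2, 4R]` with `|F| ≤ C₀`, `|F''| ≤ C₂ R⁻²`, the Fourier
coefficients `𝓕F(h/N)/N` are `≤ min(4RC₀/N, C₂N/(π²R h²))`, and summed against the greatest
common divisors `(h, n)` produced by the Ramanujan/Weil bounds for incomplete Kloosterman sums
they give `∑_{h ≠ 0} |𝓕F(h/N)|/N · (h, n) ≤ 4 √(C₀C₂) τ(n)`, uniformly in `N` and `R`.
Everything here is PROVED (Mathlib's Fourier transform `𝓕f(ξ) = ∫ f(t) e(−tξ) dt`).

* `DK_sum_min_le` (`∑_{k ≤ M} min(α, β/k²) ≤ 3√(αβ)`: the two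
  regimes `k ≤ √(β/α)` and `k > √(β/α)`), `DK_sum_min_gcd_le` (the same against `(k, n)`, losing
  `τ(n)`).
* `DK_contDiff_ofReal`, `DK_hasCompactSupport_ofReal`, `DK_integral_norm_le`,
  `DK_integral_norm_iteratedDeriv_two_le`, `DK_norm_fourier_le`, `DK_norm_fourier_le_of_ne_zero`,
  `DK_norm_fourier_div_le_min`, `DK_fourier_zero_eq`, `DK_summable_fourier_div` — the weight
  `F : ℝ → ℝ` seen as a complex function.
* `DK_sum_fourier_gcd_le` — the `h`-sum bound over an arbitrary finite set of nonzero
  frequencies (hence for the `tsum`).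

## References

* E. Bombieri, J. B. Friedlander, H. Iwaniec, Acta Math. 156 (1986), 203–251, §6, §9.
  [BombieriFriedlanderIwaniecActa1986]
* H. Iwaniec, E. Kowalski, *Analytic Number Theory*, AMS Colloquium Publ. 53 (2004), §4.3
  (Poisson summation). [IwaniecKowalski2004]
-/

noncomputable section

open Finset Real MeasureTheory
open scoped FourierTransform ContDiff ArithmeticFunction.sigma

namespace Literature.NumberTheory.LFunctions

open Literature.NumberTheory.Sieve.FriedlanderIwaniecPrimes (norm_fourier_le_integral_norm
  norm_fourier_le_div summable_fourier_div gcd_le_sum_divisors sum_Icc_filter_dvd_eq)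

/-! ### `∑ min(α, β/k²)` -/

/-- **Two regimes**: for `α, β ≥ 0` and every `M`, `∑_{k=1}^{M} min(α, β/k²) ≤ 3 √(αβ)`
(`α` for `k ≤ √(β/α)`, `β/k²` beyond). [folklore] -/
theorem DK_sum_min_le {α β : ℝ} (hα : 0 ≤ α) (hβ : 0 ≤ β) (M : ℕ) :
    ∑ k ∈ Finset.Icc 1 M, min α (β / (k : ℝ) ^ 2) ≤ 3 * Real.sqrt (α * β) := by
  rcases hα.eq_or_lt with hα0 | hα0
  · rw [← hα0]
    calc ∑ k ∈ Finset.Icc 1 M, min 0 (β / (k : ℝ) ^ 2) ≤ ∑ k ∈ Finset.Icc 1 M, (0 : ℝ) :=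
          Finset.sum_le_sum fun k _ => min_le_left _ _
      _ ≤ 3 * Real.sqrt (0 * β) := by simp
  set X : ℝ := Real.sqrt (β / α) with hX
  have hX0 : 0 ≤ X := Real.sqrt_nonneg _
  have hS0 : 0 ≤ Real.sqrt (α * β) := Real.sqrt_nonneg _
  have hαX : α * X = Real.sqrt (α * β) := by
    rw [hX, show α * Real.sqrt (β / α) = Real.sqrt (α ^ 2) * Real.sqrt (β / α) by
      rw [Real.sqrt_sq hα], ← Real.sqrt_mul (sq_nonneg α)]
    congr 1
    field_simp
  have hβX : β = Real.sqrt (α * β) * X := by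
    rw [← hαX, mul_assoc, ← sq, hX, Real.sq_sqrt (div_nonneg hβ hα), mul_div_cancel₀ _ hα0.ne']
  rw [← Finset.sum_filter_add_sum_filter_not (Finset.Icc 1 M) (fun k : ℕ => (k : ℝ) ≤ X)]
  -- `k ≤ X`: at most `X` terms, each `≤ α`
  have h1 : ∑ k ∈ (Finset.Icc 1 M).filter (fun k : ℕ => (k : ℝ) ≤ X), min α (β / (k : ℝ) ^ 2) ≤
      Real.sqrt (α * β) := by
    have hcard : (((Finset.Icc 1 M).filter (fun k : ℕ => (k : ℝ) ≤ X)).card : ℝ) ≤ X := by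
      have hsub : (Finset.Icc 1 M).filter (fun k : ℕ => (k : ℝ) ≤ X) ⊆ Finset.Icc 1 ⌊X⌋₊ := by
        intro k hk
        simp only [Finset.mem_filter, Finset.mem_Icc] at hk ⊢
        exact ⟨hk.1.1, Nat.le_floor hk.2⟩
      calc (((Finset.Icc 1 M).filter (fun k : ℕ => (k : ℝ) ≤ X)).card : ℝ)
          ≤ ((Finset.Icc 1 ⌊X⌋₊).card : ℝ) := by exact_mod_cast Finset.card_le_card hsub
        _ = ⌊X⌋₊ := by rw [Nat.card_Icc]; push_cast; ring
        _ ≤ X := Nat.floor_le hX0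
    calc ∑ k ∈ (Finset.Icc 1 M).filter (fun k : ℕ => (k : ℝ) ≤ X), min α (β / (k : ℝ) ^ 2)
        ≤ ∑ k ∈ (Finset.Icc 1 M).filter (fun k : ℕ => (k : ℝ) ≤ X), α :=
          Finset.sum_le_sum fun k _ => min_le_left _ _
      _ = (((Finset.Icc 1 M).filter (fun k : ℕ => (k : ℝ) ≤ X)).card : ℝ) * α := by
          rw [Finset.sum_const, nsmul_eq_mul]
      _ ≤ X * α := mul_le_mul_of_nonneg_right hcard hα
      _ = Real.sqrt (α * β) := by rw [mul_comm, hαX]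
  -- `k > X`: the tail of `∑ β/k²`
  have h2 : ∑ k ∈ (Finset.Icc 1 M).filter (fun k : ℕ => ¬((k : ℝ) ≤ X)),
      min α (β / (k : ℝ) ^ 2) ≤ 2 * Real.sqrt (α * β) := by
    refine (Finset.sum_le_sum fun k _ => min_le_right _ _).trans ?_
    set K : ℕ := ⌊X⌋₊ with hK
    have hXK : X < K + 1 := Nat.lt_floor_add_one X
    rcases Nat.eq_zero_or_pos K with hK0 | hK0
    · -- `X < 1`
      have hX1 : X < 1 := by rw [hK0] at hXK; simpa using hXK
      calc ∑ k ∈ (Finset.Icc 1 M).filter (fun k : ℕ => ¬((k : ℝ) ≤ X)), β / (k : ℝ) ^ 2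
          ≤ ∑ k ∈ Finset.Icc 1 M, β / (k : ℝ) ^ 2 :=
            Finset.sum_le_sum_of_subset_of_nonneg (Finset.filter_subset _ _)
              (fun k _ _ => by positivity)
        _ = β * ∑ k ∈ Finset.Icc 1 M, ((k : ℝ) ^ 2)⁻¹ := by
            rw [Finset.mul_sum]
            exact Finset.sum_congr rfl fun k _ => by rw [div_eq_mul_inv]
        _ ≤ β * 2 := mul_le_mul_of_nonneg_left (ZeroDensity.sum_Icc_inv_sq_le_two M) hβ
        _ = 2 * (Real.sqrt (α * β) * X) := by rw [← hβX]; ring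
        _ ≤ 2 * (Real.sqrt (α * β) * 1) := by gcongr
        _ = 2 * Real.sqrt (α * β) := by ring
    · -- `K ≥ 1`
      have hK1 : (1 : ℝ) ≤ K := by exact_mod_cast hK0
      have hKX : (K : ℝ) ≤ X := Nat.floor_le hX0
      have hsub : (Finset.Icc 1 M).filter (fun k : ℕ => ¬((k : ℝ) ≤ X)) ⊆
          Finset.Ioc K (max K M) := by
        intro k hk
        simp only [Finset.mem_filter, Finset.mem_Icc, not_le] at hk
        rw [Finset.mem_Ioc]
        refine ⟨?_, le_max_of_le_right hk.1.2⟩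
        have : (K : ℝ) < k := lt_of_le_of_lt hKX hk.2
        exact_mod_cast this
      calc ∑ k ∈ (Finset.Icc 1 M).filter (fun k : ℕ => ¬((k : ℝ) ≤ X)), β / (k : ℝ) ^ 2
          ≤ ∑ k ∈ Finset.Ioc K (max K M), β / (k : ℝ) ^ 2 :=
            Finset.sum_le_sum_of_subset_of_nonneg hsub (fun k _ _ => by positivity)
        _ = β * ∑ k ∈ Finset.Ioc K (max K M), ((k : ℝ) ^ 2)⁻¹ := by
            rw [Finset.mul_sum]
            exact Finset.sum_congr rfl fun k _ => by rw [div_eq_mul_inv]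
        _ ≤ β * ((K : ℝ)⁻¹ - ((max K M : ℕ) : ℝ)⁻¹) :=
            mul_le_mul_of_nonneg_left (sum_Ioc_inv_sq_le_sub hK0.ne' (le_max_left _ _)) hβ
        _ ≤ β * (K : ℝ)⁻¹ := by
            apply mul_le_mul_of_nonneg_left _ hβ
            have : (0 : ℝ) ≤ ((max K M : ℕ) : ℝ)⁻¹ := by positivity
            linarith
        _ = Real.sqrt (α * β) * (X * (K : ℝ)⁻¹) := by
            conv_lhs => rw [hβX]
            ring
        _ ≤ Real.sqrt (α * β) * 2 := by
            apply mul_le_mul_of_nonneg_left _ hS0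
            rw [mul_inv_le_iff₀ (by linarith)]
            linarith
        _ = 2 * Real.sqrt (α * β) := by ring
  linarith

/-- **With gcd weights**: for `α, β ≥ 0`, `n ≥ 1` and every `M`,
`∑_{h=1}^{M} min(α, β/h²) (h, n) ≤ 3 τ(n) √(αβ)`
(`(h,n) ≤ ∑_{g∣n, g∣h} g`, `h = g k`, and `DK_sum_min_le` with `β/g²`). [folklore] -/
theorem DK_sum_min_gcd_le {α β : ℝ} (hα : 0 ≤ α) (hβ : 0 ≤ β) {n : ℕ} (hn : 0 < n) (M : ℕ) :
    ∑ h ∈ Finset.Icc 1 M, min α (β / (h : ℝ) ^ 2) * (Nat.gcd h n : ℝ) ≤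
      3 * (σ 0 n : ℝ) * Real.sqrt (α * β) := by
  have hmin0 : ∀ h : ℕ, 0 ≤ min α (β / (h : ℝ) ^ 2) := fun h => le_min hα (by positivity)
  calc ∑ h ∈ Finset.Icc 1 M, min α (β / (h : ℝ) ^ 2) * (Nat.gcd h n : ℝ)
      ≤ ∑ h ∈ Finset.Icc 1 M, min α (β / (h : ℝ) ^ 2) *
          ∑ g ∈ n.divisors.filter (· ∣ h), (g : ℝ) :=
        Finset.sum_le_sum fun h _ =>
          mul_le_mul_of_nonneg_left (gcd_le_sum_divisors hn.ne' h) (hmin0 h)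
    _ = ∑ h ∈ Finset.Icc 1 M, ∑ g ∈ n.divisors.filter (· ∣ h),
          (g : ℝ) * min α (β / (h : ℝ) ^ 2) := by
        refine Finset.sum_congr rfl fun h _ => ?_
        rw [Finset.mul_sum]
        exact Finset.sum_congr rfl fun g _ => by ring
    _ = ∑ g ∈ n.divisors, ∑ h ∈ (Finset.Icc 1 M).filter (g ∣ ·),
          (g : ℝ) * min α (β / (h : ℝ) ^ 2) := by
        rw [Finset.sum_comm' (t' := n.divisors) (s' := fun g => (Finset.Icc 1 M).filter (g ∣ ·))]
        intro g h
        simp only [Finset.mem_filter]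
        tauto
    _ = ∑ g ∈ n.divisors, (g : ℝ) * ∑ k ∈ Finset.Icc 1 (M / g),
          min α ((β / (g : ℝ) ^ 2) / (k : ℝ) ^ 2) := by
        refine Finset.sum_congr rfl fun g hg => ?_
        have hg0 : 0 < g := Nat.pos_of_mem_divisors hg
        have hg0' : (g : ℝ) ≠ 0 := by exact_mod_cast hg0.ne'
        rw [sum_Icc_filter_dvd_eq hg0 M (fun h => (g : ℝ) * min α (β / (h : ℝ) ^ 2)),
          Finset.mul_sum]
        refine Finset.sum_congr rfl fun k _ => ?_
        congr 2
        push_cast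
        field_simp
    _ ≤ ∑ g ∈ n.divisors, (g : ℝ) * (3 * Real.sqrt (α * (β / (g : ℝ) ^ 2))) := by
        refine Finset.sum_le_sum fun g _ => ?_
        exact mul_le_mul_of_nonneg_left (DK_sum_min_le hα (by positivity) _) (Nat.cast_nonneg g)
    _ = ∑ g ∈ n.divisors, 3 * Real.sqrt (α * β) := by
        refine Finset.sum_congr rfl fun g hg => ?_
        have hg0 : 0 < g := Nat.pos_of_mem_divisors hg
        have hg0' : (0 : ℝ) < g := by exact_mod_cast hg0
        rw [show α * (β / (g : ℝ) ^ 2) = (α * β) / (g : ℝ) ^ 2 by ring,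
          Real.sqrt_div' _ (sq_nonneg _), Real.sqrt_sq hg0'.le]
        field_simp
    _ = 3 * (σ 0 n : ℝ) * Real.sqrt (α * β) := by
        rw [Finset.sum_const, nsmul_eq_mul, ArithmeticFunction.sigma_zero_apply]
        ring


/-! ### The weight `F : ℝ → ℝ` as a complex function -/

/-- Complexification preserves smoothness. [folklore] -/
theorem DK_contDiff_ofReal {F : ℝ → ℝ} (hF : ContDiff ℝ ∞ F) : ContDiff ℝ ∞ (fun x => (F x : ℂ)) :=
  Complex.ofRealCLM.contDiff.comp hF

/-- A function supported in `[R/2, 4R]` has compact support (as a complex function). [folklore] -/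
theorem DK_hasCompactSupport_ofReal {F : ℝ → ℝ} {R : ℝ}
    (hsupp : ∀ x, F x ≠ 0 → R / 2 ≤ x ∧ x ≤ 4 * R) :
    HasCompactSupport (fun x => (F x : ℂ)) := by
  refine HasCompactSupport.intro (K := Set.Icc (R / 2) (4 * R)) isCompact_Icc fun x hx => ?_
  have : F x = 0 := by
    by_contra h
    exact hx (Set.mem_Icc.mpr (hsupp x h))
  simp [this]

/-- The iterated derivative commutes with the embedding `ℝ → ℂ`. [folklore] -/
theorem DK_iteratedDeriv_ofReal {F : ℝ → ℝ} (hF : ContDiff ℝ ∞ F) (i : ℕ) (x : ℝ) :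
    iteratedDeriv i (fun t => (F t : ℂ)) x = ((iteratedDeriv i F x : ℝ) : ℂ) := by
  have h := ContinuousLinearMap.iteratedFDeriv_comp_left (Complex.ofRealCLM) (f := F) (x := x)
    (hF.contDiffAt) (i := i) (by exact_mod_cast le_top)
  rw [iteratedDeriv, iteratedDeriv, show (fun t => (F t : ℂ)) = Complex.ofRealCLM ∘ F from rfl, h]
  rfl

/-- A function supported in `[R/2, 4R]` has all its derivatives supported there. [folklore] -/
theorem DK_iteratedDeriv_eq_zero {F : ℝ → ℝ} {R : ℝ} (hsupp : ∀ x, F x ≠ 0 → R / 2 ≤ x ∧ x ≤ 4 * R)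
    (i : ℕ) {t : ℝ} (ht : ¬(R / 2 ≤ t ∧ t ≤ 4 * R)) : iteratedDeriv i F t = 0 := by
  have hts : tsupport F ⊆ Set.Icc (R / 2) (4 * R) :=
    closure_minimal (fun u hu => Set.mem_Icc.mpr (hsupp u hu)) isClosed_Icc
  have ht' : t ∉ tsupport F := fun h => ht (Set.mem_Icc.mp (hts h))
  have h0 : iteratedFDeriv ℝ i F t = 0 := by
    by_contra hne
    exact ht' (support_iteratedFDeriv_subset i (Function.mem_support.mpr hne))
  rw [iteratedDeriv, h0]
  rfl

/-- `∫ |F| ≤ 4 R C₀` for `F` supported in `[R/2, 4R]` with `|F| ≤ C₀` (`R ≥ 0`). [folklore] -/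
theorem DK_integral_norm_le {F : ℝ → ℝ} {R C₀ : ℝ} (hR : 0 ≤ R)
    (hsupp : ∀ x, F x ≠ 0 → R / 2 ≤ x ∧ x ≤ 4 * R) (hC₀ : ∀ x, ‖F x‖ ≤ C₀) :
    ∫ t, ‖((F t : ℝ) : ℂ)‖ ≤ 4 * R * C₀ := by
  have hC : 0 ≤ C₀ := (norm_nonneg _).trans (hC₀ 0)
  set S : Set ℝ := Set.Icc (R / 2) (4 * R) with hS
  have hzero : ∀ t ∉ S, ‖((F t : ℝ) : ℂ)‖ = 0 := by
    intro t ht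
    have : F t = 0 := by
      by_contra h
      exact ht (Set.mem_Icc.mpr (hsupp t h))
    simp [this]
  rw [← setIntegral_eq_integral_of_forall_compl_eq_zero hzero]
  have hvol : volume S < ⊤ := by rw [hS, Real.volume_Icc]; exact ENNReal.ofReal_lt_top
  have hb := norm_setIntegral_le_of_norm_le_const hvol (f := fun t => ‖((F t : ℝ) : ℂ)‖)
    (C := C₀) (fun t _ => by rw [norm_norm, Complex.norm_real]; exact hC₀ t)
  rw [Real.norm_of_nonneg (integral_nonneg fun _ => norm_nonneg _)] at hb
  refine hb.trans ?_
  rw [Measure.real, hS, Real.volume_Icc, ENNReal.toReal_ofReal (by linarith)]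
  nlinarith

/-- `∫ |F''| ≤ 4 C₂ / R` for `F` smooth, supported in `[R/2, 4R]`, with `|F''| ≤ C₂ R⁻²`
(`R > 0`). [folklore] -/
theorem DK_integral_norm_iteratedDeriv_two_le {F : ℝ → ℝ} {R C₂ : ℝ} (hR : 0 < R)
    (hF : ContDiff ℝ ∞ F) (hsupp : ∀ x, F x ≠ 0 → R / 2 ≤ x ∧ x ≤ 4 * R)
    (hC₂ : ∀ x, ‖iteratedDeriv 2 F x‖ ≤ C₂ / R ^ 2) :
    ∫ t, ‖iteratedDeriv 2 (fun t => (F t : ℂ)) t‖ ≤ 4 * C₂ / R := by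
  have hC : 0 ≤ C₂ := by
    have h := (norm_nonneg _).trans (hC₂ 0)
    have hR2 : 0 < R ^ 2 := by positivity
    exact (div_nonneg_iff.mp h).elim (fun h => h.1) fun h => absurd h.2 (not_le.mpr hR2)
  set S : Set ℝ := Set.Icc (R / 2) (4 * R) with hS
  have hzero : ∀ t ∉ S, ‖iteratedDeriv 2 (fun t => (F t : ℂ)) t‖ = 0 := by
    intro t ht
    rw [DK_iteratedDeriv_ofReal hF, DK_iteratedDeriv_eq_zero hsupp 2 (fun h => ht (Set.mem_Icc.mpr h))]
    simp
  rw [← setIntegral_eq_integral_of_forall_compl_eq_zero hzero]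
  have hvol : volume S < ⊤ := by rw [hS, Real.volume_Icc]; exact ENNReal.ofReal_lt_top
  have hb := norm_setIntegral_le_of_norm_le_const hvol
    (f := fun t => ‖iteratedDeriv 2 (fun t => (F t : ℂ)) t‖) (C := C₂ / R ^ 2)
    (fun t _ => by rw [norm_norm, DK_iteratedDeriv_ofReal hF, Complex.norm_real]; exact hC₂ t)
  rw [Real.norm_of_nonneg (integral_nonneg fun _ => norm_nonneg _)] at hb
  refine hb.trans ?_
  rw [Measure.real, hS, Real.volume_Icc, ENNReal.toReal_ofReal (by linarith)]
  rw [show C₂ / R ^ 2 * (4 * R - R / 2) = (7 / 2) * C₂ / R by field_simp; ring]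
  rw [div_le_div_iff_of_pos_right hR]
  nlinarith

/-- `|𝓕F(ξ)| ≤ 4RC₀`. [folklore] -/
theorem DK_norm_fourier_le {F : ℝ → ℝ} {R C₀ : ℝ} (hR : 0 ≤ R)
    (hsupp : ∀ x, F x ≠ 0 → R / 2 ≤ x ∧ x ≤ 4 * R) (hC₀ : ∀ x, ‖F x‖ ≤ C₀) (ξ : ℝ) :
    ‖𝓕 (fun t => (F t : ℂ)) ξ‖ ≤ 4 * R * C₀ :=
  (norm_fourier_le_integral_norm _ ξ).trans (DK_integral_norm_le hR hsupp hC₀)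

/-- `|𝓕F(ξ)| ≤ (4C₂/R)/(2π|ξ|)²` for `ξ ≠ 0` (two partial integrations). [folklore] -/
theorem DK_norm_fourier_le_of_ne_zero {F : ℝ → ℝ} {R C₂ : ℝ} (hR : 0 < R)
    (hF : ContDiff ℝ ∞ F) (hsupp : ∀ x, F x ≠ 0 → R / 2 ≤ x ∧ x ≤ 4 * R)
    (hC₂ : ∀ x, ‖iteratedDeriv 2 F x‖ ≤ C₂ / R ^ 2) {ξ : ℝ} (hξ : ξ ≠ 0) :
    ‖𝓕 (fun t => (F t : ℂ)) ξ‖ ≤ (4 * C₂ / R) / (2 * π * |ξ|) ^ 2 := by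
  refine (norm_fourier_le_div (DK_contDiff_ofReal hF) (DK_hasCompactSupport_ofReal hsupp) 2
    hξ).trans ?_
  gcongr
  exact DK_integral_norm_iteratedDeriv_two_le hR hF hsupp hC₂

/-- **The Fourier coefficients of the weight**: for `h ≠ 0` and `N ≥ 1`,
`|𝓕F(h/N)|/N ≤ min(4RC₀/N, C₂N/(π²R h²))`. [folklore] -/
theorem DK_norm_fourier_div_le_min {F : ℝ → ℝ} {R C₀ C₂ : ℝ} (hR : 0 < R)
    (hF : ContDiff ℝ ∞ F) (hsupp : ∀ x, F x ≠ 0 → R / 2 ≤ x ∧ x ≤ 4 * R)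
    (hC₀ : ∀ x, ‖F x‖ ≤ C₀) (hC₂ : ∀ x, ‖iteratedDeriv 2 F x‖ ≤ C₂ / R ^ 2)
    {N : ℕ} (hN : 0 < N) {h : ℤ} (hh : h ≠ 0) :
    ‖𝓕 (fun t => (F t : ℂ)) ((h : ℝ) / N)‖ / N ≤
      min (4 * R * C₀ / N) ((C₂ * N / (π ^ 2 * R)) / (h : ℝ) ^ 2) := by
  have hN' : (0 : ℝ) < N := by exact_mod_cast hN
  have hh' : (h : ℝ) ≠ 0 := by exact_mod_cast hh
  refine le_min ?_ ?_
  · exact div_le_div_of_nonneg_right (DK_norm_fourier_le hR.le hsupp hC₀ _) hN'.le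
  · have hξ : (h : ℝ) / N ≠ 0 := div_ne_zero hh' hN'.ne'
    refine (div_le_div_of_nonneg_right (DK_norm_fourier_le_of_ne_zero hR hF hsupp hC₂ hξ)
      hN'.le).trans (le_of_eq ?_)
    rw [abs_div, Nat.abs_cast, mul_pow, mul_pow, div_pow, sq_abs]
    field_simp
    ring

/-- `𝓕F(0) = ∫ F`. [folklore] -/
theorem DK_fourier_zero_eq (F : ℝ → ℝ) : 𝓕 (fun t => (F t : ℂ)) 0 = ((∫ t, F t : ℝ) : ℂ) := by
  rw [Real.fourier_real_eq]
  simp only [mul_zero, neg_zero, AddChar.map_zero_eq_one, one_smul]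
  exact integral_ofReal

/-- `h ↦ 𝓕F(h/N)` is summable over `ℤ`. [folklore] -/
theorem DK_summable_fourier_div {F : ℝ → ℝ} {R : ℝ} (hF : ContDiff ℝ ∞ F)
    (hsupp : ∀ x, F x ≠ 0 → R / 2 ≤ x ∧ x ≤ 4 * R) {N : ℕ} (hN : 0 < N) :
    Summable (fun h : ℤ => 𝓕 (fun t => (F t : ℂ)) ((h : ℝ) / N)) :=
  summable_fourier_div (DK_contDiff_ofReal hF) (DK_hasCompactSupport_ofReal hsupp)
    (by exact_mod_cast hN)

/-! ### The `h`-sum with gcd weights -/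

/-- A sum over the positive (or the negative) elements of a finite set of integers of `g(|h|)`,
`g ≥ 0`, is at most `∑_{k=1}^{M} g(k)` once `|h| ≤ M` on the set. [folklore] -/
theorem DK_sum_filter_natAbs_le {S : Finset ℤ} {g : ℕ → ℝ} (hg : ∀ k, 0 ≤ g k) {M : ℕ}
    (hM : ∀ h ∈ S, h.natAbs ≤ M) :
    ∑ h ∈ S.filter (fun h : ℤ => 0 < h), g h.natAbs ≤ ∑ k ∈ Finset.Icc 1 M, g k ∧
      ∑ h ∈ S.filter (fun h : ℤ => h < 0), g h.natAbs ≤ ∑ k ∈ Finset.Icc 1 M, g k := by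
  classical
  constructor
  · have hinj : Set.InjOn Int.natAbs (S.filter (fun h : ℤ => 0 < h) : Set ℤ) := by
      intro a ha b hb hab
      simp only [Finset.coe_filter, Set.mem_setOf_eq] at ha hb
      exact Int.natAbs_inj_of_nonneg_of_nonneg ha.2.le hb.2.le |>.mp hab
    rw [← Finset.sum_image (f := g) hinj]
    refine Finset.sum_le_sum_of_subset_of_nonneg (fun k hk => ?_) (fun k _ _ => hg k)
    simp only [Finset.mem_image, Finset.mem_filter] at hk
    obtain ⟨h, ⟨hS, hpos⟩, rfl⟩ := hk
    rw [Finset.mem_Icc]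
    exact ⟨Int.natAbs_pos.mpr hpos.ne', hM h hS⟩
  · have hinj : Set.InjOn Int.natAbs (S.filter (fun h : ℤ => h < 0) : Set ℤ) := by
      intro a ha b hb hab
      simp only [Finset.coe_filter, Set.mem_setOf_eq] at ha hb
      exact Int.natAbs_inj_of_nonpos_of_nonpos ha.2.le hb.2.le |>.mp hab
    rw [← Finset.sum_image (f := g) hinj]
    refine Finset.sum_le_sum_of_subset_of_nonneg (fun k hk => ?_) (fun k _ _ => hg k)
    simp only [Finset.mem_image, Finset.mem_filter] at hk
    obtain ⟨h, ⟨hS, hneg⟩, rfl⟩ := hk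
    rw [Finset.mem_Icc]
    exact ⟨Int.natAbs_pos.mpr hneg.ne, hM h hS⟩

/-- **The `h`-sum of the dispersion.**  For `F` smooth, supported in `[R/2, 4R]` (`R > 0`), with
`|F| ≤ C₀` and `|F''| ≤ C₂R⁻²`, for `N, n ≥ 1` and every finite set `S` of frequencies,
`∑_{h ∈ S, h ≠ 0} |𝓕F(h/N)|/N · (h, n) ≤ 4 √(C₀C₂) τ(n)`
(uniformly in `N`, `R` and `S`; the two regimes of `DK_sum_min_le` balance at
`|h| ≍ N/R`). [cite: BombieriFriedlanderIwaniecActa1986, §6 (6.9)–(6.12)] -/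
theorem DK_sum_fourier_gcd_le {F : ℝ → ℝ} {R C₀ C₂ : ℝ} (hR : 0 < R)
    (hF : ContDiff ℝ ∞ F) (hsupp : ∀ x, F x ≠ 0 → R / 2 ≤ x ∧ x ≤ 4 * R)
    (hC₀ : ∀ x, ‖F x‖ ≤ C₀) (hC₂ : ∀ x, ‖iteratedDeriv 2 F x‖ ≤ C₂ / R ^ 2)
    {N n : ℕ} (hN : 0 < N) (hn : 0 < n) (S : Finset ℤ) :
    ∑ h ∈ S, (if h = 0 then (0 : ℝ) else
        ‖𝓕 (fun t => (F t : ℂ)) ((h : ℝ) / N)‖ / N * (Int.gcd h n : ℝ)) ≤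
      4 * Real.sqrt (C₀ * C₂) * (σ 0 n : ℝ) := by
  classical
  have hC0 : 0 ≤ C₀ := (norm_nonneg _).trans (hC₀ 0)
  have hC2 : 0 ≤ C₂ := by
    have h := (norm_nonneg _).trans (hC₂ 0)
    have hR2 : 0 < R ^ 2 := by positivity
    exact (div_nonneg_iff.mp h).elim (fun h => h.1) fun h => absurd h.2 (not_le.mpr hR2)
  have hN' : (0 : ℝ) < N := by exact_mod_cast hN
  set α : ℝ := 4 * R * C₀ / N with hα
  set β : ℝ := C₂ * N / (π ^ 2 * R) with hβ
  have hα0 : 0 ≤ α := by rw [hα]; positivity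
  have hβ0 : 0 ≤ β := by rw [hβ]; positivity
  have hαβ : Real.sqrt (α * β) = 2 / π * Real.sqrt (C₀ * C₂) := by
    have h1 : α * β = (2 / π) ^ 2 * (C₀ * C₂) := by
      rw [hα, hβ]; field_simp; ring
    rw [h1, Real.sqrt_mul (sq_nonneg _), Real.sqrt_sq (by positivity)]
  set g : ℕ → ℝ := fun k => min α (β / (k : ℝ) ^ 2) * (Nat.gcd k n : ℝ) with hg
  have hg0 : ∀ k, 0 ≤ g k := fun k => mul_nonneg (le_min hα0 (by positivity)) (Nat.cast_nonneg _)
  -- pointwise comparison with `g(|h|)`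
  have hpt : ∀ h ∈ S, (if h = 0 then (0 : ℝ) else
      ‖𝓕 (fun t => (F t : ℂ)) ((h : ℝ) / N)‖ / N * (Int.gcd h n : ℝ)) ≤
      if h = 0 then (0 : ℝ) else g h.natAbs := by
    intro h _
    split_ifs with hh
    · exact le_rfl
    · have h1 := DK_norm_fourier_div_le_min hR hF hsupp hC₀ hC₂ hN hh
      have h2 : ((h.natAbs : ℕ) : ℝ) ^ 2 = (h : ℝ) ^ 2 := by
        rw [Nat.cast_natAbs, Int.cast_abs, sq_abs]
      have h3 : (Int.gcd h n : ℝ) = (Nat.gcd h.natAbs n : ℝ) := by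
        rw [Int.gcd, Int.natAbs_natCast]
      rw [hg]
      dsimp only
      rw [h2, h3]
      rw [← hα, ← hβ] at h1
      exact mul_le_mul_of_nonneg_right h1 (Nat.cast_nonneg _)
  refine (Finset.sum_le_sum hpt).trans ?_
  rw [← Finset.sum_filter_add_sum_filter_not S (fun h : ℤ => h = 0)]
  have hz : ∑ h ∈ S.filter (fun h : ℤ => h = 0), (if h = 0 then (0 : ℝ) else g h.natAbs) = 0 :=
    Finset.sum_eq_zero fun h hh => by rw [Finset.mem_filter] at hh; rw [if_pos hh.2]
  rw [hz, zero_add]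
  have hnz : ∑ h ∈ S.filter (fun h : ℤ => ¬h = 0), (if h = 0 then (0 : ℝ) else g h.natAbs) =
      ∑ h ∈ S.filter (fun h : ℤ => ¬h = 0), g h.natAbs :=
    Finset.sum_congr rfl fun h hh => by rw [Finset.mem_filter] at hh; rw [if_neg hh.2]
  rw [hnz, ← Finset.sum_filter_add_sum_filter_not (S.filter (fun h : ℤ => ¬h = 0))
    (fun h : ℤ => 0 < h), Finset.filter_filter, Finset.filter_filter]
  have hf1 : S.filter (fun h : ℤ => ¬h = 0 ∧ 0 < h) = S.filter (fun h : ℤ => 0 < h) :=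
    Finset.filter_congr fun h _ => ⟨fun hh => hh.2, fun hh => ⟨hh.ne', hh⟩⟩
  have hf2 : S.filter (fun h : ℤ => ¬h = 0 ∧ ¬0 < h) = S.filter (fun h : ℤ => h < 0) :=
    Finset.filter_congr fun h _ => by constructor <;> intro hh <;> omega
  rw [hf1, hf2]
  set M : ℕ := S.sup Int.natAbs with hM
  have hMle : ∀ h ∈ S, h.natAbs ≤ M := fun h hh => Finset.le_sup (f := Int.natAbs) hh
  obtain ⟨b1, b2⟩ := DK_sum_filter_natAbs_le hg0 hMle
  have hmain : ∑ k ∈ Finset.Icc 1 M, g k ≤ 3 * (σ 0 n : ℝ) * Real.sqrt (α * β) :=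
    DK_sum_min_gcd_le hα0 hβ0 hn M
  have hτ : (0 : ℝ) ≤ (σ 0 n : ℝ) := Nat.cast_nonneg _
  have hpi : 2 / π ≤ (2 : ℝ) / 3 := by
    rw [div_le_div_iff_of_pos_left two_pos Real.pi_pos three_pos]
    exact Real.pi_gt_three.le
  calc _ ≤ 2 * (3 * (σ 0 n : ℝ) * Real.sqrt (α * β)) := by linarith
    _ = 6 * (2 / π) * (σ 0 n : ℝ) * Real.sqrt (C₀ * C₂) := by rw [hαβ]; ring
    _ ≤ 6 * (2 / 3) * (σ 0 n : ℝ) * Real.sqrt (C₀ * C₂) := by gcongr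
    _ = 4 * Real.sqrt (C₀ * C₂) * (σ 0 n : ℝ) := by ring

end Literature.NumberTheory.LFunctions

end
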